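import Summits.QuantumFields.BalabanUV.T4Continuum.Support.NE7MinimiserLipschitzStep
import HarnessLib

/-!
# NE7MinimiserLipschitz — THE CONSTRAINED MINIMISER `U_k(V)` IS LIPSCHITZ IN THE DATUM `V` (modulo gauge, at every small datum): for every `U(n)`, every `L ≥ 2`, `d = 4`, over the
# small data, at every level `j+1` and base datum `V₀` with minimiser `U♯`: `∃ C ≥ 0`, EVENTUALLY as the unitary `N`-periodic datum `V → V₀`, every minimiser `U` over `V` has a
# unitary periodic gauge copy `U^{u}`, with corner values FIXING `V₀`, that is bondwise within `C·‖y(V)‖` of `U♯` on the period box: `‖U♯(b)⁻¹·U^{u}(b) − 1‖ ≤ C‖y(V)‖`,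
# `y(V) = skewPR N (relLog N V₀ V)` — the LIPSCHITZ upgrade of ✓ p820556 `NE7MinimiserHoelderHalf` (Hölder-½), second rung of print's «U_k(V) … analytic functions of V»
# ([Balaban1985Variational] p. 279)

Cell `pub-balaban`, rung (B)+1 sub-cell t4, lineage `b2b-balaban-t4-ne7-p1` (CRUX PROVER NE7 #1 = OWNER of BINDER row NE7), generation 114.  Memo
`t4/b2b-balaban-t4-ne7-p1-g114/ROAD-G114.md` §4–§5.
THE ARGUMENT («optimal gauge» loop).  Berge (✓ p819290 `minimisers_upperHemicontinuous`) + orbit uniqueness (✓ p810527) put a stabiliser copy of every minimiser over a nearby datum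
inside any prescribed bondwise neighbourhood of `U♯`; over the compact family of unitary periodic gauges whose corner values fix `V₀` the bond sum `Ψ(u) = Σ_b ‖U♯(b)⁻¹U^{u}(b) − 1‖`
attains its minimum at some `u⋆` (`NE7MinimiserLipschitzPrep.exists_optimal_stab_copy`); the improvement step (`NE7MinimiserLipschitzStep.improvement_step`: straightening +
rectangle + quadratic growth + near-stabiliser) produces a competitor with `Ψ ≤ A√(‖y(V)‖Ψ(u⋆)) + B‖y(V)‖`; optimality and `A√(tΨ) ≤ (A²t + Ψ)∕2` give `Ψ(u⋆) ≤ (A² + 2B)‖y(V)‖`.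
WHAT ([folklore]; 0 def, 0 sorry; `d = 4`, every `U(n)`, every `L ≥ 2`).  **`minimiser_lipschitz`** (statement in the theorem's docstring).
HONEST FRAMING (page 1): soft calculus, compactness and bookkeeping over landed kernel theorems; `C` EXISTENTIAL and NOT uniform in `V₀`, `j`, `N`; bondwise (sup) currency on the period
box; Lipschitz only (print: analytic); nothing of Bałaban's asserted as an axiom and NOT his method; finite 4-torus, small data; NOT NE7 as a spine node (dagwriter∕referees' call), NOT
NE3; spine 0∕9; NOT infinite volume, NOT mass gap, NOT BetaPertH, NOT Clay (continuum YM on T⁴ ⇐ BetaPertH ∧ nine spine estimates).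
-/

set_option autoImplicit false

open scoped BigOperators Matrix Matrix.Norms.L2Operator Topology
open NormedSpace Finset Set Filter Metric

namespace Summit.QuantumFields.BalabanUV.T4Continuum.NE7MinimiserLipschitz

open Literature.MathematicalPhysics.QuantumFieldTheory.Balaban1983to89
open B7Prop1Explicit B7Prop2Explicit
open T4AveragingDeficitWall (IsUnitaryCfg SmallField)
open T4AveragingDeficitWallBoundary (IsPeriodicCfg)
open AveragingDeficitTorusChart (TDir chart)
open AveragingDeficitChartCalculus (relLog)
open AveragingDeficitTwoLevelPrep (skewSub skewPR)
open AveragingDeficitMultiLevelPrep (tower)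
open MinimalActionSandwich (IsMinimiser admissible)
open MinimalActionRate (sfClass)
open NE3EnergyShapes (IsUnitarySite IsPeriodicSite)
open NE7AdmissibleFibreLHC (period_succ_eq continuous_relVal)
open NE7MinimalOrbitDatumContinuity (thresholds minimisers_upperHemicontinuous)
open NE7MinimalOrbitDatumContinuityGauge (continuous_gaugeAct)
open NE7MinimalOrbitUniqueGeneric (minimal_orbit_unique_generic)
open NE7EtaMinimiserGaugeCovariance (avgIter_gaugeAct_sfClass)
open AveragingDeficitKDatum (gaugeAct_inv_gaugeAct)
open NE7MinimiserLipschitzPrep (exists_optimal_stab_copy term_le_sum)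
open NE7MinimiserLipschitzStep (improvement_step)

noncomputable section

variable {n : Type} [Fintype n] [DecidableEq n]

set_option maxHeartbeats 800000 in
/-- **`U_k(V)` IS LIPSCHITZ IN `V` MODULO GAUGE, EVERY `U(n)`, EVERY `L ≥ 2`, `d = 4`.**  Over the small data, at every level `j+1` and base datum `V₀`: there is a minimiser `U♯` over `V₀`
and `C ≥ 0` such that EVENTUALLY as the unitary `N`-periodic datum `V → V₀`, every minimiser `U` over `V` admits a unitary `(N·L^{j+1})`-periodic gauge `u` whose corner values fix
`V₀` (`u(L^{j+1}z)·V₀(z,κ)·u(L^{j+1}(z+e_κ))⁻¹ = V₀(z,κ)`) with `‖U♯(boxVec r, κ)⁻¹·(U^{u})(boxVec r, κ) − 1‖ ≤ C·‖skewPR N (relLog N V₀ V)‖` for every bond of the period box.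
[folklore] -/
theorem minimiser_lipschitz [Nonempty n] {L : ℕ} [NeZero L] (hL : 2 ≤ L) :
    ∃ ε₀ : ℝ, 0 < ε₀ ∧ ∀ ε : ℝ, 0 < ε → ε ≤ ε₀ → ∀ (N : ℕ) [NeZero N], 1 ≤ N →
      ∃ δV : ℝ, 0 < δV ∧
        ∀ V₀ ∈ {V : Site 4 → Fin 4 → (Matrix n n ℂ)ˣ | IsUnitaryCfg V ∧ IsPeriodicCfg V (N : ℤ) ∧ SmallField V δV},
        ∀ j : ℕ, ∃ Us : Site 4 → Fin 4 → (Matrix n n ℂ)ˣ, IsMinimiser 4 (sfClass 4 L N ε) L N (j + 1) V₀ Us ∧ ∃ C : ℝ, 0 ≤ C ∧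
          ∀ᶠ V in 𝓝 V₀, IsUnitaryCfg V → IsPeriodicCfg V (N : ℤ) →
            ∀ U : Site 4 → Fin 4 → (Matrix n n ℂ)ˣ, IsMinimiser 4 (sfClass 4 L N ε) L N (j + 1) V U →
              ∃ u : Site 4 → (Matrix n n ℂ)ˣ, IsUnitarySite u ∧ IsPeriodicSite u ((N * L ^ (j + 1) : ℕ) : ℤ) ∧
                (∀ (z : Site 4) (κ : Fin 4), (u (((L : ℤ) ^ (j + 1)) • z) : Matrix n n ℂ) * (V₀ z κ : Matrix n n ℂ)
                  * (((u (((L : ℤ) ^ (j + 1)) • (z + e κ)))⁻¹ : (Matrix n n ℂ)ˣ) : Matrix n n ℂ) = V₀ z κ) ∧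
                ∀ (r : Fin 4 → Fin (L * tower L N j)) (κ : Fin 4),
                  ‖(((Us (boxVec (L * tower L N j) r) κ)⁻¹ : (Matrix n n ℂ)ˣ) : Matrix n n ℂ)
                      * ((gaugeAct u U (boxVec (L * tower L N j) r) κ : (Matrix n n ℂ)ˣ) : Matrix n n ℂ) - 1‖ ≤ C * ‖skewPR N (relLog N V₀ V)‖ := by
  have hL1 : 1 ≤ L := by omega
  obtain ⟨ε₁, hε₁, H⟩ := thresholds (n := n) hL
  obtain ⟨ε₂, hε₂, H2⟩ := minimisers_upperHemicontinuous (n := n) hL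
  obtain ⟨ε₃, hε₃, H3⟩ := minimal_orbit_unique_generic (n := n) hL
  obtain ⟨ε₄, hε₄, H4⟩ := improvement_step (n := n) hL
  refine ⟨min ε₁ (min ε₂ (min ε₃ ε₄)), lt_min hε₁ (lt_min hε₂ (lt_min hε₃ hε₄)), fun ε hε hεle N _ hN => ?_⟩
  obtain ⟨-, -, hls, -⟩ := H ε hε (hεle.trans (min_le_left _ _))
  obtain ⟨δ₂, hδ₂, husc⟩ := H2 ε hε (hεle.trans ((min_le_right _ _).trans (min_le_left _ _))) N hN
  obtain ⟨δ₃, hδ₃, huniq⟩ := H3 ε hε (hεle.trans ((min_le_right _ _).trans ((min_le_right _ _).trans (min_le_left _ _)))) N hN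
  obtain ⟨δ₄, hδ₄, hstep⟩ := H4 ε hε (hεle.trans ((min_le_right _ _).trans ((min_le_right _ _).trans (min_le_right _ _)))) N hN
  refine ⟨min δ₂ (min δ₃ δ₄), lt_min hδ₂ (lt_min hδ₃ hδ₄), fun V₀ hV₀ j => ?_⟩
  obtain ⟨hV₀u, hV₀P, hV₀δ⟩ := hV₀
  have hV₀2 : V₀ ∈ {V : Site 4 → Fin 4 → (Matrix n n ℂ)ˣ | IsUnitaryCfg V ∧ IsPeriodicCfg V (N : ℤ) ∧ SmallField V δ₂} :=
    ⟨hV₀u, hV₀P, MinimalActionRate.SmallField.mono hV₀δ (min_le_left _ _)⟩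
  have hV₀3 : V₀ ∈ {V : Site 4 → Fin 4 → (Matrix n n ℂ)ˣ | IsUnitaryCfg V ∧ IsPeriodicCfg V (N : ℤ) ∧ SmallField V δ₃} :=
    ⟨hV₀u, hV₀P, MinimalActionRate.SmallField.mono hV₀δ ((min_le_right _ _).trans (min_le_left _ _))⟩
  have hV₀4 : V₀ ∈ {V : Site 4 → Fin 4 → (Matrix n n ℂ)ˣ | IsUnitaryCfg V ∧ IsPeriodicCfg V (N : ℤ) ∧ SmallField V δ₄} :=
    ⟨hV₀u, hV₀P, MinimalActionRate.SmallField.mono hV₀δ ((min_le_right _ _).trans (min_le_right _ _))⟩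
  -- the improvement step at `(V₀, U♯)`
  obtain ⟨Us, hUs, δ₁, A, B, hδ₁, hA, hB, hstepev⟩ := hstep V₀ hV₀4 j
  set M : ℕ := L * tower L N j with hMdef
  have hper : N * L ^ (j + 1) = M := by rw [hMdef]; exact period_succ_eq L N j
  haveI : NeZero M := ⟨by rw [← hper]; exact Nat.mul_ne_zero (NeZero.ne N) (pow_ne_zero _ (by omega))⟩
  set Cb : ℝ := (Fintype.card ((Fin 4 → Fin M) × Fin 4) : ℝ) with hCb
  have hCb0 : 0 ≤ Cb := by positivity
  refine ⟨Us, hUs, A ^ 2 + 2 * B, by positivity, ?_⟩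
  -- the localising open set: a stabiliser copy with all bond terms `< δ₁ ∕ (Cb + 1)`
  set δ : ℝ := δ₁ / (Cb + 1) with hδ
  have hδ0 : 0 < δ := by positivity
  set 𝒰 : Set (Site 4 → Fin 4 → (Matrix n n ℂ)ˣ) := {U | ∃ u : Site 4 → (Matrix n n ℂ)ˣ, IsUnitarySite u ∧ IsPeriodicSite u ((N * L ^ (j + 1) : ℕ) : ℤ) ∧
    (∀ (z : Site 4) (κ : Fin 4), (u (((L : ℤ) ^ (j + 1)) • z) : Matrix n n ℂ) * (V₀ z κ : Matrix n n ℂ)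
      * (((u (((L : ℤ) ^ (j + 1)) • (z + e κ)))⁻¹ : (Matrix n n ℂ)ˣ) : Matrix n n ℂ) = V₀ z κ) ∧
    ∀ (r : Fin 4 → Fin M) (κ : Fin 4), ‖(((Us (boxVec M r) κ)⁻¹ : (Matrix n n ℂ)ˣ) : Matrix n n ℂ) * ((gaugeAct u U (boxVec M r) κ : (Matrix n n ℂ)ˣ) : Matrix n n ℂ) - 1‖ < δ}
    with h𝒰
  have h𝒰o : IsOpen 𝒰 := by
    rw [isOpen_iff_mem_nhds]
    rintro U ⟨u, hu, huP, hfix, hUn⟩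
    have hopen : IsOpen {X : Site 4 → Fin 4 → (Matrix n n ℂ)ˣ | ∀ (r : Fin 4 → Fin M) (κ : Fin 4),
        ‖(((Us (boxVec M r) κ)⁻¹ : (Matrix n n ℂ)ˣ) : Matrix n n ℂ) * ((X (boxVec M r) κ : (Matrix n n ℂ)ˣ) : Matrix n n ℂ) - 1‖ < δ} := by
      simp only [Set.setOf_forall]
      exact isOpen_iInter_of_finite fun r => isOpen_iInter_of_finite fun κ =>
        isOpen_lt (((continuous_relVal Us (boxVec M r) κ).sub continuous_const).norm) continuous_const
    exact mem_of_superset ((hopen.preimage (continuous_gaugeAct u)).mem_nhds hUn) fun U' hU' => ⟨u, hu, huP, hfix, hU'⟩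
  -- every minimiser over `V₀` is in `𝒰` (orbit uniqueness)
  obtain ⟨Us', -, horbit⟩ := huniq V₀ hV₀3 (j + 1)
  obtain ⟨us, hus, husP, hgs⟩ := horbit Us hUs
  have h𝒰min : ∀ U' : Site 4 → Fin 4 → (Matrix n n ℂ)ˣ, IsMinimiser 4 (sfClass 4 L N ε) L N (j + 1) V₀ U' → U' ∈ 𝒰 := by
    intro U' hU'
    obtain ⟨u', hu', hu'P, hg'⟩ := horbit U' hU'
    set u : Site 4 → (Matrix n n ℂ)ˣ := fun z => (us z)⁻¹ * u' z with hudef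
    have hu : IsUnitarySite u := fun z => (unitaryUnits (Matrix n n ℂ)).mul_mem ((unitaryUnits (Matrix n n ℂ)).inv_mem (hus z)) (hu' z)
    have huP : IsPeriodicSite u ((N * L ^ (j + 1) : ℕ) : ℤ) := fun x i => by simp only [hudef, husP x i, hu'P x i]
    have hgU : gaugeAct u U' = Us := by
      have hmul : gaugeAct u U' = gaugeAct (fun z => (us z)⁻¹) (gaugeAct u' U') := by
        funext x μ; simp only [hudef, gaugeAct]; group
      rw [hmul, hg', ← hgs, gaugeAct_inv_gaugeAct]
    have hfix : gaugeAct (fun z : Site 4 => u (((L : ℤ) ^ (j + 1)) • z)) V₀ = V₀ := by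
      have h := avgIter_gaugeAct_sfClass hL1 hε.le j (hls j) hU'.mem.1 hu
      rw [hgU, hUs.mem.2, hU'.mem.2] at h
      exact h.symm
    refine ⟨u, hu, huP, fun z κ => ?_, fun r κ => ?_⟩
    · have h := congr_fun (congr_fun hfix z) κ
      have h' := congrArg (fun v : (Matrix n n ℂ)ˣ => (v : Matrix n n ℂ)) h
      simpa only [gaugeAct, Units.val_mul] using h'
    · rw [hgU, Units.inv_mul, sub_self, norm_zero]; exact hδ0
  -- Berge, and the improvement step
  filter_upwards [husc V₀ hV₀2 (j + 1) 𝒰 h𝒰o h𝒰min, hstepev] with V hV𝒰 hVstep hVu hVP U hU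
  obtain ⟨u₀, hu₀, hu₀P, hu₀fix, hu₀n⟩ := hV𝒰 hVu hVP U hU
  set t : ℝ := ‖skewPR N (relLog N V₀ V)‖ with ht
  have ht0 : 0 ≤ t := norm_nonneg _
  set Ψ : (Site 4 → (Matrix n n ℂ)ˣ) → ℝ := fun v => ∑ rκ : (Fin 4 → Fin M) × Fin 4,
    ‖(((Us (boxVec M rκ.1) rκ.2)⁻¹ : (Matrix n n ℂ)ˣ) : Matrix n n ℂ) * ((gaugeAct v U (boxVec M rκ.1) rκ.2 : (Matrix n n ℂ)ˣ) : Matrix n n ℂ) - 1‖ with hΨdef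
  -- the optimal stabiliser copy
  obtain ⟨us, husu, husP', husfix, hopt⟩ := exists_optimal_stab_copy (M := M) ((N * L ^ (j + 1) : ℕ) : ℤ) ((L : ℤ) ^ (j + 1)) V₀ Us U hu₀ hu₀P hu₀fix
  have hΨ0 : 0 ≤ Ψ us := Finset.sum_nonneg fun _ _ => norm_nonneg _
  have hΨu₀ : Ψ u₀ ≤ δ₁ := by
    have h1 : Ψ u₀ ≤ ∑ _rκ : (Fin 4 → Fin M) × Fin 4, δ := Finset.sum_le_sum fun rκ _ => (hu₀n rκ.1 rκ.2).le
    rw [Finset.sum_const, nsmul_eq_mul, Finset.card_univ, ← hCb] at h1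
    have h2 : Cb * δ ≤ δ₁ := by
      rw [hδ, mul_div_assoc']
      exact (div_le_iff₀ (by positivity)).mpr (by nlinarith)
    exact h1.trans h2
  have hΨus : Ψ us ≤ δ₁ := (hopt u₀ hu₀ hu₀P hu₀fix).trans hΨu₀
  obtain ⟨uc, hucu, hucP, hucfix, hucΨ⟩ := hVstep hVu hVP U hU us husu husP' husfix hΨus
  have hmin : Ψ us ≤ Ψ uc := hopt uc hucu hucP hucfix
  -- `Ψ(u⋆) ≤ A√(tΨ(u⋆)) + Bt` ⟹ `Ψ(u⋆) ≤ (A² + 2B)t`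
  have hkey : Ψ us ≤ (A ^ 2 + 2 * B) * t := by
    have h1 : Ψ us ≤ A * Real.sqrt (t * Ψ us) + B * t := hmin.trans hucΨ
    have h2 : A * Real.sqrt (t * Ψ us) ≤ (A ^ 2 * t + Ψ us) / 2 := by
      rw [Real.sqrt_mul ht0]
      nlinarith [sq_nonneg (A * Real.sqrt t - Real.sqrt (Ψ us)), Real.sq_sqrt ht0, Real.sq_sqrt hΨ0]
    linarith
  refine ⟨us, husu, husP', husfix, fun r κ => ?_⟩
  exact (term_le_sum (f := fun rκ : (Fin 4 → Fin M) × Fin 4 => ‖(((Us (boxVec M rκ.1) rκ.2)⁻¹ : (Matrix n n ℂ)ˣ) : Matrix n n ℂ)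
    * ((gaugeAct us U (boxVec M rκ.1) rκ.2 : (Matrix n n ℂ)ˣ) : Matrix n n ℂ) - 1‖) (fun _ => norm_nonneg _) (r, κ)).trans hkey

end

end Summit.QuantumFields.BalabanUV.T4Continuum.NE7MinimiserLipschitz
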